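import Literature.Algebra.EuclideanLattices.MRGapCVPEstimates
import Literature.Algebra.EuclideanLattices.SmoothingGaussianExpectations
import Literature.Algebra.EuclideanLattices.SmoothingGaussianTail
import Literature.Probability.Moments.IndependentVectorSums
import Mathlib.Probability.HasLaw
import Mathlib.Probability.Independence.Basic
import Mathlib.MeasureTheory.Integral.Prod
import Mathlib.MeasureTheory.Function.SpecialFunctions.Inner
import HarnessLib

/-!
# Micciancio–Regev 2007, proof of Thm. 5.23 (`GapCVP′ → SIS′`): the witness distribution, eqs. (16)–(18) — proved

Topic `Algebra/EuclideanLattices` (family `pqc`); serves the decomposition of the named fact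
`Literature.Computability.Cryptography.MicciancioRegev2007_gapCVP'_to_SIS'` (MR07 Thm. 5.23 proper,
`GapSVPToSIS.lean`), sequel of `MRGapCVPEstimates.lean` (the parameter estimates).

In the NO-case analysis of the reduction (authors' version pp. 30–31) one sample of the witness
matrix `W` is `w = x - Yz`, produced by the procedure `W(B, S)` from the pairs `(cᵢ, yᵢ)` of the
sampling procedure (Lemma 5.7), the query/answer `(A, z)` of the SIS′ oracle and the vector `x` of the
combining procedure (Lemma 5.8). The three per-sample bounds that feed Hoeffding's inequality (test
(b)) and Lemma 5.20 (test (c)) are proved "even when we condition on any fixed values of `C`, `A`, and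
`z`" (p. 30), in which situation "the only randomness left is in `y₁, …, y_m` where each `yᵢ` is
distributed according to `D_{L(B)*,s,cᵢ}`" (p. 30, independently — Lemma 5.7 is run `m` times with
independent coins) and, writing `w = x - Yz = (x - Cz) - (Y - C)z` (p. 31, first display),
`e := x - Cz` is a FIXED vector with `‖e‖ < sβ` (Lemma 5.8 and eq. (15); tree:
`MicciancioRegev2007.combine_error_le`, `MicciancioRegev2007.two_mul_mul_lt`). This file proves the
three bounds in exactly that conditional setting, in Mathlib's language: a probability space
`(Ω, P)`, independent (`iIndepFun`) random lattice vectors `yᵢ : Ω → Λ` with laws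
`HasLaw (yᵢ) D_{Λ,s,cᵢ}` (`discreteGaussian`, `DiscreteGaussian.lean`), a fixed `e`, fixed centres
`cᵢ` and a fixed integer vector `z`, and the witness sample
`w(ω) = e - ∑ᵢ zᵢ • (yᵢ(ω) - cᵢ)`:

* `MicciancioRegev2007.measureReal_lt_norm_witness_le` — **eq. (17), union-bound form** (p. 31): for
  `0 < ε < 1`, `η_ε(Λ) ≤ s`, `Pr[‖e‖ + s√n ∑ᵢ|zᵢ| < ‖w‖] ≤ m · (1+ε)/(1-ε) · 2⁻ⁿ` (Lemma 4.4 for each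
  `yᵢ`, tree: `measureReal_discreteGaussian_norm_sub_ge_le`, union bound, triangle inequality);
  `…witness_le_of_lt` — **eq. (17) as consumed by Lemma 5.20** with `K = √(nm)`, `ℓ = 2sβ`:
  if `‖e‖ < sβ` and `‖z‖ ≤ β` then `Pr[√(nm) · 2sβ ≤ ‖w‖] ≤ m (1+ε)/(1-ε) 2⁻ⁿ`
  ("`sβ + √(nm) sβ < 2√(nm) sβ`"; `∑|zᵢ| ≤ √m ‖z‖`). Independence is not used here.
* `MicciancioRegev2007.integral_inner_witness_sq_le` — **eq. (18) with (19), (20)** (p. 31): for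
  `0 < ε < 1`, `2η_ε(Λ) ≤ s` and a unit vector `u`,
  `E⟨u, w⟩² ≤ 2‖e‖² + 2((1/(2π) + ε/(1-ε)) s² + (εs/(1-ε))² m) ‖z‖²`
  ("`⟨u,w⟩² ≤ 2‖x - Cz‖² + 2⟨u,(Y-C)z⟩²`", Lemma 4.2 (i)/(ii) in expectation form, tree:
  `abs_integral_discreteGaussian_inner_sub_le`, `abs_integral_discreteGaussian_inner_sub_sq_sub_le`,
  and Lemma 2.11 for the one-dimensional vectors `⟨u, yᵢ - cᵢ⟩`, tree:
  `Literature.Probability.Moments.MicciancioRegev2007.integral_norm_sq_sum_smul_le`);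
  `…_le_sq` — the consumed form `E⟨u, w⟩² ≤ (2sβ)²` when `‖e‖ ≤ sβ`, `‖z‖ ≤ β` and
  `1/(2π) + ε/(1-ε) + (ε/(1-ε))² m ≤ 1` (p. 31: "`≤ s²β²`", "`< 2(sβ)² + 2(sβ)² = 4s²β²`").
* `MicciancioRegev2007.integral_cos_witness_le` — **eq. (16)** (p. 30): if `Λ = L*` for a full-rank
  `L` of dimension `n ≥ 2` with `λ₁(L) > γd > 0`, `s = 2√n/(γd)`, `zⱼ ≠ 0` and
  `dist(-zⱼ t, L) > γd` (the NO promise of `GapCVP′` for the odd integer `-zⱼ`), then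
  `E cos(2π⟨t, w⟩) ≤ 2 · 2⁻ⁿ` — "condition on `y₁, …, yⱼ₋₁, yⱼ₊₁, …, y_m` … `w = -zⱼ(ŵ + yⱼ)` …
  Corollary 4.6": independence of `yⱼ` from the rest (`iIndepFun.indepFun_finset`), the law of the
  pair as a product measure, Fubini, and the one-sample bound
  `MicciancioRegev2007.integral_cos_le_of_far` (`MRGapCVPEstimates.lean`). Only the law of `yⱼ` is
  needed.

Theorems only (no definitions, no named facts); the sample is written out as
`e - ∑ i, (z i : ℝ) • ((y i ω : V) - c i)` in every statement.

## References

* D. Micciancio, O. Regev, *Worst-case to average-case reductions based on Gaussian measures*,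
  SIAM J. Comput. 37 (2007) 267–302; authors' version (`lit read doi:10.1137/S0097539705447360`),
  proof of Thm. 5.23, eq. (16) p. 30, eqs. (17)–(20) pp. 30–31.
-/

noncomputable section

open MeasureTheory ProbabilityTheory Module Metric Finset
open scoped Real InnerProductSpace

namespace Literature.Algebra.EuclideanLattices

namespace MicciancioRegev2007

variable {V : Type*} [NormedAddCommGroup V] [InnerProductSpace ℝ V] [FiniteDimensional ℝ V]
  [MeasurableSpace V] [BorelSpace V]
variable (Λ : Submodule ℤ V) [DiscreteTopology Λ] [IsZLattice ℝ Λ]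
variable {Ω : Type*} [MeasurableSpace Ω] {P : Measure Ω} [IsProbabilityMeasure P]
variable {m : ℕ}

/-! ### Deterministic inequalities for one sample `w = e - ∑ᵢ zᵢ (xᵢ - cᵢ)` -/

omit [FiniteDimensional ℝ V] [MeasurableSpace V] [BorelSpace V] in
/-- Triangle inequality for the witness sample (p. 31: "by union bound and triangle inequality"):
`‖e - ∑ᵢ zᵢ(xᵢ - cᵢ)‖ ≤ ‖e‖ + ∑ᵢ |zᵢ| ‖xᵢ - cᵢ‖`. [cite: MicciancioRegev2007, Thm. 5.23 (proof, p. 31, eq. (17))] -/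
theorem norm_witness_le (e : V) (c x : Fin m → V) (z : Fin m → ℤ) :
    ‖e - ∑ i, (z i : ℝ) • (x i - c i)‖ ≤ ‖e‖ + ∑ i, |(z i : ℝ)| * ‖x i - c i‖ := by
  refine (norm_sub_le _ _).trans ?_
  gcongr
  refine (norm_sum_le _ _).trans (le_of_eq (Finset.sum_congr rfl fun i _ => ?_))
  rw [norm_smul, Real.norm_eq_abs]

omit [FiniteDimensional ℝ V] [MeasurableSpace V] [BorelSpace V] in
/-- `∑ᵢ |zᵢ| ≤ √m β` when `‖z‖² = ∑ᵢ zᵢ² ≤ β²` (Cauchy–Schwarz; p. 31: "`∑ᵢ |zᵢ| ≤ √m β`", for the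
SIS′ solution `‖z‖ ≤ β`). [cite: MicciancioRegev2007, Thm. 5.23 (proof, p. 31, eq. (17))] -/
theorem sum_abs_le_sqrt_mul {β : ℝ} (hβ : 0 ≤ β) (z : Fin m → ℤ)
    (hz : ∑ i, (z i : ℝ) ^ 2 ≤ β ^ 2) : ∑ i, |(z i : ℝ)| ≤ Real.sqrt m * β := by
  have hcs : (∑ i, |(z i : ℝ)|) ^ 2 ≤ m * β ^ 2 := by
    calc (∑ i, |(z i : ℝ)|) ^ 2 = (∑ i, 1 * |(z i : ℝ)|) ^ 2 := by simp
      _ ≤ (∑ _i : Fin m, (1 : ℝ) ^ 2) * ∑ i, |(z i : ℝ)| ^ 2 := sum_mul_sq_le_sq_mul_sq _ _ _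
      _ = m * ∑ i, (z i : ℝ) ^ 2 := by simp
      _ ≤ m * β ^ 2 := by gcongr
  calc ∑ i, |(z i : ℝ)| ≤ Real.sqrt ((∑ i, |(z i : ℝ)|) ^ 2) := by
        rw [Real.sqrt_sq (Finset.sum_nonneg fun i _ => abs_nonneg _)]
    _ ≤ Real.sqrt (m * β ^ 2) := Real.sqrt_le_sqrt hcs
    _ = Real.sqrt m * β := by rw [Real.sqrt_mul (Nat.cast_nonneg m), Real.sqrt_sq hβ]

omit [FiniteDimensional ℝ V] [MeasurableSpace V] [BorelSpace V] in
/-- The pairing of the witness sample with a vector splits off the fixed part (p. 31: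
"`⟨u, w⟩ = ⟨u, x - Cz⟩ - ⟨u, (Y - C)z⟩`"): `⟨u, e - ∑ᵢ zᵢ(xᵢ - cᵢ)⟩ = ⟨u, e⟩ - ∑ᵢ zᵢ ⟨u, xᵢ - cᵢ⟩`.
[cite: MicciancioRegev2007, Thm. 5.23 (proof, p. 31, eq. (18))] -/
theorem inner_witness_eq (u e : V) (c x : Fin m → V) (z : Fin m → ℤ) :
    ⟪u, e - ∑ i, (z i : ℝ) • (x i - c i)⟫_ℝ = ⟪u, e⟫_ℝ - ∑ i, (z i : ℝ) * ⟪u, x i - c i⟫_ℝ := by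
  rw [inner_sub_right, inner_sum]
  simp_rw [real_inner_smul_right]

/-! ### Eq. (17): the witness sample is short except with probability `m (1+ε)/(1-ε) 2⁻ⁿ` -/

/-- **MR07 eq. (17), union-bound form** (p. 31): let `0 < ε < 1`, `0 < s`, `η_ε(Λ) ≤ s`, and let
`y₁, …, y_m` be random vectors of `Λ` with `yᵢ ∼ D_{Λ,s,cᵢ}` (no independence needed). Then for every
fixed `e` and integer vector `z`, the sample `w = e - ∑ᵢ zᵢ(yᵢ - cᵢ)` satisfies
`Pr[‖e‖ + s√n ∑ᵢ |zᵢ| < ‖w‖] ≤ m · (1+ε)/(1-ε) · 2⁻ⁿ`: on the complement of the `m` events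
`{‖yᵢ - cᵢ‖ ≥ s√n}`, each of probability `≤ (1+ε)/(1-ε) 2⁻ⁿ` by Lemma 4.4, the triangle inequality
bounds `‖w‖`. [cite: MicciancioRegev2007, Thm. 5.23 (proof, p. 31, eq. (17))] -/
theorem measureReal_lt_norm_witness_le {ε s : ℝ} (hε : 0 < ε) (hε1 : ε < 1) (hs : 0 < s)
    (hηs : smoothingParameter Λ ε ≤ s) (c : Fin m → V) {y : Fin m → Ω → Λ}
    (hy : ∀ i, HasLaw (y i) (discreteGaussian Λ s (c i)).toMeasure P) (e : V) (z : Fin m → ℤ) :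
    P.real {ω | ‖e‖ + s * Real.sqrt (finrank ℝ V) * ∑ i, |(z i : ℝ)| <
        ‖e - ∑ i, (z i : ℝ) • ((y i ω : V) - c i)‖} ≤
      m * ((1 + ε) / (1 - ε) * (2⁻¹ : ℝ) ^ finrank ℝ V) := by
  set tail : Fin m → Set Ω :=
    fun i => {ω | s * Real.sqrt (finrank ℝ V) ≤ ‖(y i ω : V) - c i‖} with htail_def
  have hsub : {ω | ‖e‖ + s * Real.sqrt (finrank ℝ V) * ∑ i, |(z i : ℝ)| <
      ‖e - ∑ i, (z i : ℝ) • ((y i ω : V) - c i)‖} ⊆ ⋃ i, tail i := by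
    intro ω hω
    by_contra hcon
    simp only [Set.mem_iUnion, not_exists, htail_def, Set.mem_setOf_eq, not_le] at hcon
    have h1 := norm_witness_le e c (fun i => (y i ω : V)) z
    have h2 : ∑ i, |(z i : ℝ)| * ‖(y i ω : V) - c i‖ ≤
        ∑ i, |(z i : ℝ)| * (s * Real.sqrt (finrank ℝ V)) :=
      Finset.sum_le_sum fun i _ => mul_le_mul_of_nonneg_left (hcon i).le (abs_nonneg _)
    rw [← Finset.sum_mul] at h2
    simp only [Set.mem_setOf_eq] at hω
    linarith [mul_comm (∑ i, |(z i : ℝ)|) (s * Real.sqrt (finrank ℝ V))]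
  have htail : ∀ i, P.real (tail i) ≤ (1 + ε) / (1 - ε) * (2⁻¹ : ℝ) ^ finrank ℝ V := fun i => by
    have h := (hy i).measureReal_eq
      (p := fun x : Λ => s * Real.sqrt (finrank ℝ V) ≤ ‖(x : V) - c i‖)
      (Set.to_countable _).measurableSet
    simp only [htail_def]
    rw [h]
    exact measureReal_discreteGaussian_norm_sub_ge_le Λ hε hε1 hs hηs (c i)
  calc P.real _ ≤ P.real (⋃ i, tail i) := measureReal_mono hsub
    _ ≤ ∑ i, P.real (tail i) := measureReal_iUnion_fintype_le _
    _ ≤ ∑ _i : Fin m, (1 + ε) / (1 - ε) * (2⁻¹ : ℝ) ^ finrank ℝ V :=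
        Finset.sum_le_sum fun i _ => htail i
    _ = m * ((1 + ε) / (1 - ε) * (2⁻¹ : ℝ) ^ finrank ℝ V) := by
        rw [Finset.sum_const, Finset.card_univ, Fintype.card_fin, nsmul_eq_mul]

/-- **MR07 eq. (17), as consumed by Lemma 5.20** (p. 30–31: `Pr{‖w‖ ≥ Kℓ} ≤ σ` with `ℓ = 2sβ` and
`K = √(nm)` — so `Kℓ = 2√(nm) sβ`, `K⁴ = n²m²`, `e^{-N/K⁴} = e^{-nm}` for `N = n³m³`): if moreover
`‖e‖ < sβ` (Lemma 5.8 with eq. (15)) and `‖z‖ ≤ β` (an SIS′ solution), then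
`Pr[√(nm) · (2sβ) ≤ ‖w‖] ≤ m · (1+ε)/(1-ε) · 2⁻ⁿ`, because `‖e‖ + s√n ∑|zᵢ| < sβ + √(nm) sβ ≤ 2√(nm) sβ`
as soon as `nm ≥ 1` ("for all sufficiently large `n`", p. 31). [cite: MicciancioRegev2007, Thm. 5.23 (proof, pp. 30–31, eq. (17))] -/
theorem measureReal_le_norm_witness_le_of_lt {ε s β : ℝ} (hε : 0 < ε) (hε1 : ε < 1) (hs : 0 < s)
    (hηs : smoothingParameter Λ ε ≤ s) (c : Fin m → V) {y : Fin m → Ω → Λ}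
    (hy : ∀ i, HasLaw (y i) (discreteGaussian Λ s (c i)).toMeasure P) {e : V} (he : ‖e‖ < s * β)
    {z : Fin m → ℤ} (hz : ∑ i, (z i : ℝ) ^ 2 ≤ β ^ 2) (hnm : 1 ≤ finrank ℝ V * m) :
    P.real {ω | Real.sqrt (finrank ℝ V * m) * (2 * s * β) ≤
        ‖e - ∑ i, (z i : ℝ) • ((y i ω : V) - c i)‖} ≤
      m * ((1 + ε) / (1 - ε) * (2⁻¹ : ℝ) ^ finrank ℝ V) := by
  have hβ : 0 < β := by
    by_contra h
    push Not at h
    have : s * β ≤ 0 := mul_nonpos_of_nonneg_of_nonpos hs.le h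
    linarith [norm_nonneg e]
  have hzsum := sum_abs_le_sqrt_mul hβ.le z hz
  have hsq : Real.sqrt (finrank ℝ V * m) = Real.sqrt (finrank ℝ V) * Real.sqrt m :=
    Real.sqrt_mul (Nat.cast_nonneg _) _
  have hone : 1 ≤ Real.sqrt (finrank ℝ V * m) := by
    rw [Real.one_le_sqrt]
    exact_mod_cast hnm
  refine le_trans (measureReal_mono (fun ω hω => ?_)) (measureReal_lt_norm_witness_le Λ hε hε1 hs hηs c hy e z)
  simp only [Set.mem_setOf_eq] at hω ⊢
  refine lt_of_lt_of_le ?_ hω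
  have h1 : s * Real.sqrt (finrank ℝ V) * ∑ i, |(z i : ℝ)| ≤
      s * Real.sqrt (finrank ℝ V) * (Real.sqrt m * β) :=
    mul_le_mul_of_nonneg_left hzsum (by positivity)
  have h2 : s * β ≤ Real.sqrt (finrank ℝ V * m) * (s * β) :=
    le_mul_of_one_le_left (by positivity) hone
  calc ‖e‖ + s * Real.sqrt (finrank ℝ V) * ∑ i, |(z i : ℝ)|
      < s * β + s * Real.sqrt (finrank ℝ V) * (Real.sqrt m * β) := by linarith
    _ = s * β + Real.sqrt (finrank ℝ V * m) * (s * β) := by rw [hsq]; ring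
    _ ≤ Real.sqrt (finrank ℝ V * m) * (s * β) + Real.sqrt (finrank ℝ V * m) * (s * β) := by
        linarith
    _ = Real.sqrt (finrank ℝ V * m) * (2 * s * β) := by ring

/-! ### Eq. (18): second moments of the witness sample in a fixed direction -/

/-- The one-dimensional marginals `⟨x - c, u⟩` of `D_{Λ,s,c}` are square integrable (`0 < s`; the
Gaussian series `∑ ⟨x - c, u⟩² ρ_s(x - c)` converges). [cite: MicciancioRegev2007, Lemma 4.2] -/
theorem memLp_two_inner_coe_sub {s : ℝ} (hs : 0 < s) (c u : V) :
    MemLp (fun x : Λ => ⟪(x : V) - c, u⟫_ℝ) 2 (discreteGaussian Λ s c).toMeasure := by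
  refine (memLp_two_iff_integrable_sq (measurable_of_countable _).aestronglyMeasurable).2 ?_
  refine integrable_toMeasure_of_summable _ ?_
  simp_rw [discreteGaussian_toReal Λ hs c]
  have h := summable_inner_sq_mul_gaussianFunction_sub Λ hs c u
  refine (h.div_const (∑' y : Λ, gaussianFunction s ((y : V) - c))).congr fun x => ?_
  rw [abs_of_nonneg (sq_nonneg _)]
  ring

/-- **MR07 eq. (18) with (19) and (20)** (p. 31): let `0 < ε < 1`, `0 < s`, `2η_ε(Λ) ≤ s`, let
`y₁, …, y_m` be independent random vectors of `Λ` with `yᵢ ∼ D_{Λ,s,cᵢ}`, and let `u` be a unit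
vector. Then for every fixed `e` and integer vector `z`, the sample `w = e - ∑ᵢ zᵢ(yᵢ - cᵢ)` has
`E⟨u, w⟩² ≤ 2‖e‖² + 2((1/(2π) + ε/(1-ε)) s² + (εs/(1-ε))² m) ∑ᵢ zᵢ²` — as printed:
`⟨u, w⟩² ≤ 2⟨u, e⟩² + 2⟨u, (Y-C)z⟩² ≤ 2‖e‖² + 2⟨u, (Y-C)z⟩²`; by Lemma 4.2,
`|E⟨u, yᵢ - cᵢ⟩| ≤ εs/(1-ε)` (19) and `E⟨u, yᵢ - cᵢ⟩² ≤ (1/(2π) + ε/(1-ε)) s²` (20); and Lemma 2.11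
for the one-dimensional vectors `vᵢ = ⟨u, yᵢ - cᵢ⟩` gives
`E⟨u, (Y-C)z⟩² = E(∑ᵢ zᵢvᵢ)² ≤ ((1/(2π) + ε/(1-ε)) s² + (εs/(1-ε))² m) ‖z‖²`.
[cite: MicciancioRegev2007, Thm. 5.23 (proof, p. 31, eqs. (18)–(20))] -/
theorem integral_inner_witness_sq_le {ε s : ℝ} (hε : 0 < ε) (hε1 : ε < 1) (hs : 0 < s)
    (hηs : 2 * smoothingParameter Λ ε ≤ s) (c : Fin m → V) {y : Fin m → Ω → Λ}
    (hmeas : ∀ i, Measurable (y i)) (hind : iIndepFun y P)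
    (hy : ∀ i, HasLaw (y i) (discreteGaussian Λ s (c i)).toMeasure P) (e : V) (z : Fin m → ℤ)
    {u : V} (hu : ‖u‖ = 1) :
    ∫ ω, ⟪u, e - ∑ i, (z i : ℝ) • ((y i ω : V) - c i)⟫_ℝ ^ 2 ∂P ≤
      2 * ‖e‖ ^ 2 + 2 * ((((1 / (2 * π) + ε / (1 - ε)) * s ^ 2 + (ε * s / (1 - ε)) ^ 2 * m)) *
        ∑ i, (z i : ℝ) ^ 2) := by
  have hε1' : 0 < 1 - ε := by linarith
  -- the one-dimensional vectors of Lemma 2.11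
  set v : Fin m → Ω → ℝ := fun i ω => ⟪(y i ω : V) - c i, u⟫_ℝ with hv
  have hvind : iIndepFun v P :=
    hind.comp (fun i (x : Λ) => ⟪(x : V) - c i, u⟫_ℝ) fun i => measurable_of_countable _
  have hvL2 : ∀ i, MemLp (v i) 2 P := fun i => by
    have h := memLp_two_inner_coe_sub Λ hs (c i) u
    rw [← (hy i).map_eq] at h
    exact h.comp_of_map (hy i).aemeasurable
  -- (20): second moments
  have hl : ∀ i, ∫ ω, ‖v i ω‖ ^ 2 ∂P ≤ (1 / (2 * π) + ε / (1 - ε)) * s ^ 2 := fun i => by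
    have h := (hy i).integral_comp (f := fun x : Λ => ⟪(x : V) - c i, u⟫_ℝ ^ 2)
      (measurable_of_countable _).aestronglyMeasurable
    have h20 := abs_integral_discreteGaussian_inner_sub_sq_sub_le Λ hε hε1 hs hηs (c i) u
    rw [hu, one_pow, mul_one, mul_one] at h20
    have hI : ∫ ω, ‖v i ω‖ ^ 2 ∂P =
        ∫ x, ⟪(x : V) - c i, u⟫_ℝ ^ 2 ∂(discreteGaussian Λ s (c i)).toMeasure := by
      rw [← h]
      refine integral_congr_ae (ae_of_all _ fun ω => ?_)
      simp only [hv, Function.comp_apply, Real.norm_eq_abs, sq_abs]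
    rw [hI]
    have := (abs_le.1 h20).2
    have hrew : (1 / (2 * π) + ε / (1 - ε)) * s ^ 2 = s ^ 2 / (2 * π) + ε * s ^ 2 / (1 - ε) := by
      ring
    rw [hrew]
    linarith
  -- (19): means
  have hε' : ∀ i, ‖∫ ω, v i ω ∂P‖ ^ 2 ≤ (ε * s / (1 - ε)) ^ 2 := fun i => by
    have h := (hy i).integral_comp (f := fun x : Λ => ⟪(x : V) - c i, u⟫_ℝ)
      (measurable_of_countable _).aestronglyMeasurable
    have h19 := abs_integral_discreteGaussian_inner_sub_le Λ hε hε1 hs hηs (c i) u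
    rw [hu, mul_one] at h19
    have hI : ∫ ω, v i ω ∂P = ∫ x, ⟪(x : V) - c i, u⟫_ℝ ∂(discreteGaussian Λ s (c i)).toMeasure := h
    rw [hI, Real.norm_eq_abs]
    exact pow_le_pow_left₀ (abs_nonneg _) h19 2
  -- Lemma 2.11
  have h211 := Literature.Probability.Moments.MicciancioRegev2007.integral_norm_sq_sum_smul_le
    hvind hvL2 hl hε' (fun i => (z i : ℝ))
  -- pointwise: `⟨u, w⟩² ≤ 2‖e‖² + 2(∑ zᵢvᵢ)²`
  have hpt : ∀ ω, ⟪u, e - ∑ i, (z i : ℝ) • ((y i ω : V) - c i)⟫_ℝ ^ 2 ≤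
      2 * ‖e‖ ^ 2 + 2 * ‖∑ i, (z i : ℝ) • v i ω‖ ^ 2 := fun ω => by
    have hsplit : ⟪u, e - ∑ i, (z i : ℝ) • ((y i ω : V) - c i)⟫_ℝ =
        ⟪u, e⟫_ℝ - ∑ i, (z i : ℝ) • v i ω := by
      rw [inner_witness_eq]
      simp only [hv, smul_eq_mul, real_inner_comm u]
    have hue : |⟪u, e⟫_ℝ| ≤ ‖e‖ := by
      have := abs_real_inner_le_norm u e
      rwa [hu, one_mul] at this
    have h1 : ⟪u, e⟫_ℝ ^ 2 ≤ ‖e‖ ^ 2 := by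
      rw [← sq_abs]
      exact pow_le_pow_left₀ (abs_nonneg _) hue 2
    rw [hsplit, Real.norm_eq_abs, sq_abs]
    nlinarith [sq_nonneg (⟪u, e⟫_ℝ + ∑ i, (z i : ℝ) • v i ω)]
  -- integrability
  have hsumL2 : MemLp (fun ω => ∑ i, (z i : ℝ) • v i ω) 2 P :=
    memLp_finsetSum _ fun i _ => (hvL2 i).const_smul (z i : ℝ)
  have hint2 : Integrable (fun ω => ‖∑ i, (z i : ℝ) • v i ω‖ ^ 2) P :=
    (memLp_two_iff_integrable_sq_norm hsumL2.aestronglyMeasurable).1 hsumL2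
  have hint_rhs : Integrable (fun ω => 2 * ‖e‖ ^ 2 + 2 * ‖∑ i, (z i : ℝ) • v i ω‖ ^ 2) P :=
    (integrable_const _).add (hint2.const_mul 2)
  have hwm : Measurable fun ω => e - ∑ i, (z i : ℝ) • ((y i ω : V) - c i) :=
    measurable_const.sub (Finset.measurable_sum _ fun i _ =>
      ((measurable_subtype_coe.comp (hmeas i)).sub measurable_const).const_smul _)
  have hint_lhs : Integrable (fun ω => ⟪u, e - ∑ i, (z i : ℝ) • ((y i ω : V) - c i)⟫_ℝ ^ 2) P := by
    refine hint_rhs.mono' ((Measurable.inner measurable_const hwm).pow_const 2).aestronglyMeasurable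
      (ae_of_all _ fun ω => ?_)
    rw [Real.norm_eq_abs, abs_of_nonneg (sq_nonneg _)]
    exact hpt ω
  calc ∫ ω, ⟪u, e - ∑ i, (z i : ℝ) • ((y i ω : V) - c i)⟫_ℝ ^ 2 ∂P
      ≤ ∫ ω, (2 * ‖e‖ ^ 2 + 2 * ‖∑ i, (z i : ℝ) • v i ω‖ ^ 2) ∂P :=
        integral_mono hint_lhs hint_rhs hpt
    _ = 2 * ‖e‖ ^ 2 + 2 * ∫ ω, ‖∑ i, (z i : ℝ) • v i ω‖ ^ 2 ∂P := by
        rw [integral_add (integrable_const _) (hint2.const_mul 2), integral_const, integral_const_mul]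
        simp
    _ ≤ _ := by linarith [h211]

/-- **MR07 eq. (18), as consumed by Lemma 5.20** (p. 31, with `ℓ = 2sβ`): if moreover `‖e‖ ≤ sβ`,
`‖z‖ ≤ β` and `1/(2π) + ε/(1-ε) + (ε/(1-ε))² m ≤ 1` ("for all sufficiently large `n`": `ε = 2⁻ⁿ`,
`m = n^{O(1)}`), then `E⟨u, w⟩² ≤ (2sβ)²` for every unit vector `u` (print:
"`Exp[⟨u, (Y-C)z⟩²] ≤ … ≤ s²β²`", "`Exp[⟨u, w⟩²] < 2(sβ)² + 2(sβ)² = 4s²β²`").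
[cite: MicciancioRegev2007, Thm. 5.23 (proof, p. 31, eq. (18))] -/
theorem integral_inner_witness_sq_le_sq {ε s β : ℝ} (hε : 0 < ε) (hε1 : ε < 1) (hs : 0 < s)
    (hηs : 2 * smoothingParameter Λ ε ≤ s) (c : Fin m → V) {y : Fin m → Ω → Λ}
    (hmeas : ∀ i, Measurable (y i)) (hind : iIndepFun y P)
    (hy : ∀ i, HasLaw (y i) (discreteGaussian Λ s (c i)).toMeasure P) {e : V} (he : ‖e‖ ≤ s * β)
    {z : Fin m → ℤ} (hz : ∑ i, (z i : ℝ) ^ 2 ≤ β ^ 2)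
    (hnum : 1 / (2 * π) + ε / (1 - ε) + (ε / (1 - ε)) ^ 2 * m ≤ 1) {u : V} (hu : ‖u‖ = 1) :
    ∫ ω, ⟪u, e - ∑ i, (z i : ℝ) • ((y i ω : V) - c i)⟫_ℝ ^ 2 ∂P ≤ (2 * s * β) ^ 2 := by
  refine (integral_inner_witness_sq_le Λ hε hε1 hs hηs c hmeas hind hy e z hu).trans ?_
  have hzsum : 0 ≤ ∑ i, (z i : ℝ) ^ 2 := Finset.sum_nonneg fun i _ => sq_nonneg _
  have hcoef : (1 / (2 * π) + ε / (1 - ε)) * s ^ 2 + (ε * s / (1 - ε)) ^ 2 * m =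
      s ^ 2 * (1 / (2 * π) + ε / (1 - ε) + (ε / (1 - ε)) ^ 2 * m) := by ring
  have h1 : ((1 / (2 * π) + ε / (1 - ε)) * s ^ 2 + (ε * s / (1 - ε)) ^ 2 * m) * ∑ i, (z i : ℝ) ^ 2 ≤
      s ^ 2 * β ^ 2 := by
    rw [hcoef]
    calc s ^ 2 * (1 / (2 * π) + ε / (1 - ε) + (ε / (1 - ε)) ^ 2 * m) * ∑ i, (z i : ℝ) ^ 2
        ≤ s ^ 2 * 1 * β ^ 2 :=
          mul_le_mul (mul_le_mul_of_nonneg_left hnum (sq_nonneg s)) hz hzsum (by positivity)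
      _ = s ^ 2 * β ^ 2 := by ring
  have h2 : ‖e‖ ^ 2 ≤ (s * β) ^ 2 := pow_le_pow_left₀ (norm_nonneg _) he 2
  nlinarith

/-! ### Eq. (16): the expected cosine of one witness sample is exponentially small on a NO instance -/

/-- **MR07 eq. (16)** (p. 30): let `L` be a full-rank lattice of dimension `n ≥ 2` and `g = γd` with
`0 < g < λ₁(L)` (first NO condition of `GapCVP′_γ`); let `y₁, …, y_m` be independent random vectors
of `L*` with `yⱼ ∼ D_{L*,s,cⱼ}` for `s = 2√n/g` (eq. (15): `η_{2⁻ⁿ}(L*) < s/2`), where `j` is an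
index with `zⱼ ≠ 0` such that `dist(-zⱼ t, L) > g` (second NO condition, `-zⱼ` odd). Then for every
fixed `e`, `E[cos(2π⟨t, w⟩)] ≤ 2 · 2⁻ⁿ` for the sample `w = e - ∑ᵢ zᵢ(yᵢ - cᵢ)`. Proof as printed:
conditioning on `(yᵢ)_{i ≠ j}` (independence: the law of `((yᵢ)_{i≠j}, yⱼ)` is a product, Fubini),
`w = -zⱼ(yⱼ + ŵ)` with `ŵ = -cⱼ - zⱼ⁻¹ · (e - ∑_{i≠j} zᵢ(yᵢ - cᵢ))` fixed, so
`cos(2π⟨t, w⟩) = cos(2π⟨yⱼ + ŵ, -zⱼt⟩)`, and Cor. 4.6 with eq. (15) bounds the conditional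
expectation by `(1+ε)/(1-ε) · 2⁻ⁿ ≤ 2⁻ⁿ⁺¹` (`MicciancioRegev2007.integral_cos_le_of_far`).
[cite: MicciancioRegev2007, Thm. 5.23 (proof, p. 30, eq. (16))] -/
theorem integral_cos_witness_le (L : Submodule ℤ V) [DiscreteTopology L] [IsZLattice ℝ L]
    (hn : 2 ≤ finrank ℝ V) {g : ℝ} (hg : 0 < g) (hgL : g < minNorm L) (c : Fin m → V)
    {y : Fin m → Ω → dualLattice L} (hmeas : ∀ i, Measurable (y i)) (hind : iIndepFun y P)
    {j : Fin m}
    (hyj : HasLaw (y j)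
      (discreteGaussian (dualLattice L) (2 * Real.sqrt (finrank ℝ V) / g) (c j)).toMeasure P)
    (e t : V) {z : Fin m → ℤ} (hzj : z j ≠ 0)
    (hfar : g < infDist (((-z j : ℤ) : ℝ) • t) (L : Set V)) :
    ∫ ω, Real.cos (2 * π * ⟪t, e - ∑ i, (z i : ℝ) • ((y i ω : V) - c i)⟫_ℝ) ∂P ≤
      2 * (2⁻¹ : ℝ) ^ finrank ℝ V := by
  classical
  set T : Finset (Fin m) := Finset.univ.erase j with hT
  -- the part of the sample not involving `y j`, as a function of the tuple `(y i)_{i ≠ j}`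
  set G : (T → dualLattice L) → V := fun f => e - ∑ i : T, (z i : ℝ) • ((f i : V) - c i) with hG
  set yT : Ω → (T → dualLattice L) := fun ω i => y i ω with hyT
  set R : Ω → V := G ∘ yT with hR
  have hsplit : ∀ ω, e - ∑ i, (z i : ℝ) • ((y i ω : V) - c i) =
      R ω - (z j : ℝ) • ((y j ω : V) - c j) := fun ω => by
    simp only [hR, hG, hyT, Function.comp_apply]
    rw [Finset.sum_coe_sort T (fun i => (z i : ℝ) • ((y i ω : V) - c i)), hT,
      ← Finset.add_sum_erase _ _ (Finset.mem_univ j)]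
    abel
  have hGm : Measurable G := Measurable.of_discrete
  have hyTm : Measurable yT := measurable_pi_lambda _ fun i => hmeas i
  have hRm : Measurable R := hGm.comp hyTm
  -- `y j` is independent of `R`
  have hind' : IndepFun (y j) R P := by
    have hdisj : Disjoint ({j} : Finset (Fin m)) T := by simp [hT]
    have h1 := hind.indepFun_finset {j} T hdisj hmeas
    exact h1.comp (φ := fun f : (({j} : Finset (Fin m)) → dualLattice L) =>
      f ⟨j, Finset.mem_singleton_self j⟩) (measurable_pi_apply _) hGm
  -- hence the law of the pair `(R, y j)` is the product of the laws
  have hpair : P.map (fun ω => (R ω, y j ω)) = (P.map R).prod (P.map (y j)) :=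
    (indepFun_iff_map_prod_eq_prod_map_map hRm.aemeasurable (hmeas j).aemeasurable).1 hind'.symm
  -- the integrand as a bounded measurable function of the pair
  set F : V × dualLattice L → ℝ :=
    fun p => Real.cos (2 * π * ⟪t, p.1 - (z j : ℝ) • ((p.2 : V) - c j)⟫_ℝ) with hF
  have hFm : Measurable F := by
    refine measurable_from_prod_countable_left fun x => ?_
    show Measurable fun r : V => Real.cos (2 * π * ⟪t, r - (z j : ℝ) • ((x : V) - c j)⟫_ℝ)
    exact Real.measurable_cos.comp
      (Measurable.mul measurable_const (Measurable.inner measurable_const (measurable_id.sub_const _)))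
  have hFbd : ∀ p, ‖F p‖ ≤ 1 := fun p => by
    simp only [hF, Real.norm_eq_abs]
    exact Real.abs_cos_le_one _
  have hFint : Integrable F ((P.map R).prod (P.map (y j))) :=
    Integrable.of_bound hFm.aestronglyMeasurable 1 (ae_of_all _ hFbd)
  have hcomp : (fun ω => Real.cos (2 * π * ⟪t, e - ∑ i, (z i : ℝ) • ((y i ω : V) - c i)⟫_ℝ)) =
      fun ω => F (R ω, y j ω) := by
    funext ω
    simp only [hF, hsplit ω]
  have hmap : ∫ ω, F (R ω, y j ω) ∂P = ∫ p, F p ∂(P.map fun ω => (R ω, y j ω)) :=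
    (integral_map (hRm.prodMk (hmeas j)).aemeasurable hFm.aestronglyMeasurable).symm
  have hint_inner : Integrable (fun r => ∫ x, F (r, x) ∂(P.map (y j))) (P.map R) :=
    hFint.integral_prod_left
  rw [hcomp, hmap, hpair, integral_prod F hFint, hyj.map_eq]
  rw [hyj.map_eq] at hint_inner
  -- the inner integral is bounded for every value `r` of `R` (Cor. 4.6 via eq. (15))
  have hinner : ∀ r : V,
      ∫ x, F (r, x) ∂(discreteGaussian (dualLattice L) (2 * Real.sqrt (finrank ℝ V) / g) (c j)).toMeasure ≤
        2 * (2⁻¹ : ℝ) ^ finrank ℝ V := fun r => by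
    have hzr : (z j : ℝ) ≠ 0 := by exact_mod_cast hzj
    set ŵ : V := -c j - (z j : ℝ)⁻¹ • r with hŵ
    have heq : ∀ x : dualLattice L, F (r, x) =
        Real.cos (2 * π * ⟪(x : V) + ŵ, ((-z j : ℤ) : ℝ) • t⟫_ℝ) := fun x => by
      simp only [hF, hŵ]
      congr 1
      rw [Int.cast_neg, real_inner_smul_right, inner_sub_right, real_inner_smul_right,
        inner_sub_right, inner_add_left, inner_sub_left, inner_neg_left, real_inner_smul_left,
        real_inner_comm t (x : V), real_inner_comm t (c j), real_inner_comm t r]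
      field_simp
      ring
    simp_rw [heq]
    exact integral_cos_le_of_far L hn hg hgL hfar (c j) ŵ
  haveI : IsProbabilityMeasure (P.map R) := Measure.isProbabilityMeasure_map hRm.aemeasurable
  refine (integral_mono hint_inner (integrable_const _) hinner).trans (le_of_eq ?_)
  simp

end MicciancioRegev2007

end Literature.Algebra.EuclideanLattices

end
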